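import Summits.ValiantsHypothesis.ValiantsHypothesis.Theorems.BarrierLeverChowBenchmarkPairsPureSplittableChain
import Summits.ValiantsHypothesis.ValiantsHypothesis.Theorems.BarrierLeverChowBenchmarkPairsHaar

/-!
# Route BarrierLever — item 22038 `ChowBenchmarkPairs`, line `moore-peel`: CONJECTURE HAAR for CYCLES — the first non-forest family
# in the kernel: for every `m ≥ 4` the `m` edge rows of a cycle are nonsingular on the first `m` binary codes (some table)

Helper file (`--supports stmt-ValiantsHypothesis-22038`; cell valiant-natproofs, rung V4; seat val-np-p4 gen 23).  Closes NO item.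

The planner's refuter target for node #6 `stub_haar` (R16) was «2-regular sub-families (disjoint cycles)».  Memo HOME/val-np-p4/g23/ §8 (THEOREM D2)
proves them Haar on paper; this file puts the basic case in the kernel: the CYCLE `v_0 v_1 … v_{m−1} v_0` (`m ≥ 4`, `v` injective into `Fin h`,
`m ≤ 2^h`), rows `{v_t, v_{t+1 mod m}}`, columns `benchCols h m j` (`j < m`): `haar_cycle`.  The derivation (`PSr`, `…PureSplittableChain`): ONE
pure split at the coordinate `0` (the lowest bit) with `I = {v_1, …, v_{b−1}}`, `b = ⌊m/2⌋`: the TOUCHING rows are the edges `{v_i, v_{i+1}}`,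
`i < b` (a path — a chain, weight raised at `v_{max(i,1)}`), on the ODD codes `2i+1` (which contain the bit `0`); the INSIDE rows are the other
`a = ⌈m/2⌉` edges `{v_{b+i}, v_{b+i+1 mod m}}` (a path — a chain), on the EVEN codes `2i`.  Both code families are chains (a later code is never a
subset of an earlier one, `benchCols_not_subset_of_lt`), so `psr_chain` certifies both halves, `PSr.split` glues them, and the cycle matrix is the
glued matrix with rows and columns permuted (`Matrix.det_permute`, `Matrix.det_submatrix_equiv_self`).

WHAT THIS IS NOT: no stub of the line is closed; nothing on crux stmt-ValiantsHypothesis-14610 or on `VP` versus `VNP`.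
-/

set_option linter.dupNamespace false

namespace Summit.ValiantsHypothesis.ValiantsHypothesis.Theorems.BarrierLever.ChowBenchmarkHaar

open Finset
open Summit.ValiantsHypothesis.ValiantsHypothesis.Theorems.BarrierLever.MoorePeel (benchCols)
open Summit.ValiantsHypothesis.ValiantsHypothesis.Theorems.BarrierLever.ChowBenchmarkPeel (segE)
open Summit.ValiantsHypothesis.ValiantsHypothesis.Theorems.BarrierLever.ChowBenchmarkSplit
  (dirE dirE_one genT PSr psr_chain det_genTable_ne_zero_of_psr exists_table_of_psr map_dirE)

section Cycle

variable {h m : ℕ}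

/-- Vertex `t mod m` of the cycle. -/
def vx (v : Fin m → Fin h) (hm0 : 0 < m) (t : ℕ) : Fin h := v ⟨t % m, Nat.mod_lt _ hm0⟩

/-- Edge `t` of the cycle: `{v_t, v_{t+1 mod m}}`. -/
def cycEdge (v : Fin m → Fin h) (hm0 : 0 < m) (t : ℕ) : Finset (Fin h) := {vx v hm0 t, vx v hm0 (t + 1)}

/-- Below `m` the vertex is read directly. -/
theorem vx_of_lt (v : Fin m → Fin h) (hm0 : 0 < m) {t : ℕ} (ht : t < m) : vx v hm0 t = v ⟨t, ht⟩ := by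
  simp [vx, Nat.mod_eq_of_lt ht]

/-- Vertices are distinct along the cycle (`v` injective). -/
theorem vx_inj (v : Fin m → Fin h) (hm0 : 0 < m) (hv : Function.Injective v) {s t : ℕ} (hs : s < m) (ht : t < m)
    (e : vx v hm0 s = vx v hm0 t) : s = t := by
  rw [vx_of_lt v hm0 hs, vx_of_lt v hm0 ht] at e
  exact Fin.mk.inj_iff.mp (hv e)

/-- The cycle closes up: vertex `m` is vertex `0`. -/
theorem vx_mod_self (v : Fin m → Fin h) (hm0 : 0 < m) : vx v hm0 m = vx v hm0 0 := by
  simp [vx]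

/-! ### The code columns: even codes (inside) and odd codes (touching) -/

/-- The even code `2i` as an element of `Fin m` (`i < m − m/2`). -/
def evenCode (m : ℕ) (i : Fin (m - m / 2)) : Fin m := ⟨2 * i.val, by have := i.2; omega⟩

/-- The odd code `2i+1` as an element of `Fin m` (`i < m/2`). -/
def oddCode (m : ℕ) (i : Fin (m / 2)) : Fin m := ⟨2 * i.val + 1, by have := i.2; omega⟩

/-- Even codes do not contain the bit `0`. -/
theorem zero_not_mem_benchCols_even (h0 : 0 < h) (i : Fin (m - m / 2)) :
    (⟨0, h0⟩ : Fin h) ∉ benchCols h m (evenCode m i) := by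
  intro hmem
  have := (Finset.mem_filter.mp hmem).2
  rw [evenCode, Fin.val_mk, Nat.testBit_zero] at this
  simp at this

/-- Odd codes contain the bit `0`. -/
theorem zero_mem_benchCols_odd (h0 : 0 < h) (i : Fin (m / 2)) :
    (⟨0, h0⟩ : Fin h) ∈ benchCols h m (oddCode m i) := by
  refine Finset.mem_filter.mpr ⟨Finset.mem_univ _, ?_⟩
  rw [oddCode, Fin.val_mk, Nat.testBit_zero]
  simp

/-! ### The dominance rank: `ρ (v t) = t` -/

/-- Rank of a vertex: its index along `v` (and `0` off the cycle). -/
noncomputable def rk (v : Fin m → Fin h) (p : Fin h) : ℕ :=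
  if hp : ∃ t : Fin m, v t = p then (Classical.choose hp).val else 0

/-- The rank of the `t`-th vertex is `t`. -/
theorem rk_v (v : Fin m → Fin h) (hv : Function.Injective v) (t : Fin m) : rk v (v t) = t.val := by
  unfold rk
  have hp : ∃ s : Fin m, v s = v t := ⟨t, rfl⟩
  rw [dif_pos hp]
  exact congrArg Fin.val (hv (Classical.choose_spec hp))

/-! ### The theorem -/

/-- **HAAR FOR CYCLES.**  For `m ≥ 4`, `m ≤ 2^h` and an injective `v : Fin m → Fin h`, some table makes the `m × m` matrix «cycle edges
`{v_t, v_{t+1 mod m}}` × the first `m` binary codes» of segment entries nonsingular. -/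
theorem haar_cycle (hm : 4 ≤ m) (hmh : m ≤ 2 ^ h) (h0 : 0 < h) (v : Fin m → Fin h) (hv : Function.Injective v) :
    ∃ P : Fin h → Fin h → ℂ,
      (Matrix.of fun t j : Fin m => segE P (cycEdge v (by omega) t.val) (benchCols h m j)).det ≠ 0 := by
  classical
  have hm0 : 0 < m := by omega
  -- sizes
  set a := m - m / 2 with ha
  set b := m / 2 with hb
  have hab : a + b = m := by omega
  have hb2 : 2 ≤ b := by omega
  have ha2 : 2 ≤ a := by omega
  -- data of the split
  let c0 : Fin h := ⟨0, h0⟩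
  let I : Finset (Fin h) := (Finset.univ.filter fun t : Fin m => 1 ≤ t.val ∧ t.val ≤ b - 1).image v
  let S₁ : Fin a → Finset (Fin h) := fun i => cycEdge v hm0 (b + i.val)
  let S₂ : Fin b → Finset (Fin h) := fun i => cycEdge v hm0 i.val
  let T₁ : Fin a → Finset (Fin h) := fun i => benchCols h m (evenCode m i)
  let T₂ : Fin b → Finset (Fin h) := fun i => (benchCols h m (oddCode m i)).erase c0
  let y : Fin b → Fin h := fun i => vx v hm0 (max i.val 1)
  let w1a : Fin a → Fin h → ℕ := fun _ _ => 1
  let w1b : Fin b → Fin h → ℕ := fun _ _ => 1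
  -- membership in I
  have memI : ∀ t : ℕ, t < m → (vx v hm0 t ∈ I ↔ 1 ≤ t ∧ t ≤ b - 1) := by
    intro t ht
    rw [vx_of_lt v hm0 ht]
    constructor
    · intro hmem
      obtain ⟨s, hs, e⟩ := Finset.mem_image.mp hmem
      have hs' := (Finset.mem_filter.mp hs).2
      have hst : s = ⟨t, ht⟩ := hv e
      subst hst
      exact hs'
    · intro ⟨h1, h2⟩
      exact Finset.mem_image.mpr ⟨⟨t, ht⟩, Finset.mem_filter.mpr ⟨Finset.mem_univ _, h1, h2⟩, rfl⟩
  -- (1) the INSIDE chain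
  have hin : PSr S₁ w1a T₁ := by
    refine psr_chain a S₁ w1a T₁ (fun i => vx v hm0 (b + i.val + 1)) ?_ ?_ (fun _ => le_refl 1) ?_
    · intro i
      show vx v hm0 (b + i.val + 1) ∈ ({vx v hm0 (b + i.val), vx v hm0 (b + i.val + 1)} : Finset (Fin h))
      simp
    · intro s i hsi hmem
      have hs := s.2
      have hi := i.2
      have hsi' : s.val < i.val := hsi
      have hmem' : vx v hm0 (b + i.val + 1) = vx v hm0 (b + s.val) ∨ vx v hm0 (b + i.val + 1) = vx v hm0 (b + s.val + 1) := by
        simpa [S₁, cycEdge] using hmem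
      by_cases hlast : b + i.val + 1 = m
      · rw [hlast, vx_mod_self] at hmem'
        rcases hmem' with e | e
        · have := vx_inj v hm0 hv hm0 (by omega) e; omega
        · have := vx_inj v hm0 hv hm0 (by omega) e; omega
      · rcases hmem' with e | e
        · have := vx_inj v hm0 hv (by omega) (by omega) e; omega
        · have := vx_inj v hm0 hv (by omega) (by omega) e; omega
    · intro s i hsi
      exact benchCols_not_subset_of_lt hmh (evenCode m s) (evenCode m i)
        (by show (evenCode m s).val < (evenCode m i).val; simp only [evenCode]; have : s.val < i.val := hsi; omega)
  -- (2) the TOUCHING chain (weights raised at `y i`)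
  have htouch : PSr S₂ (fun i => Function.update (w1b i) (y i) (w1b i (y i) + 1)) T₂ := by
    refine psr_chain b S₂ _ T₂ (fun i => vx v hm0 (i.val + 1)) ?_ ?_ ?_ ?_
    · intro i
      show vx v hm0 (i.val + 1) ∈ ({vx v hm0 i.val, vx v hm0 (i.val + 1)} : Finset (Fin h))
      simp
    · intro s i hsi hmem
      have hsi' : s.val < i.val := hsi
      have hs := s.2
      have hi := i.2
      have hmem' : vx v hm0 (i.val + 1) = vx v hm0 s.val ∨ vx v hm0 (i.val + 1) = vx v hm0 (s.val + 1) := by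
        simpa [S₂, cycEdge] using hmem
      rcases hmem' with e | e
      · have := vx_inj v hm0 hv (by omega) (by omega) e; omega
      · have := vx_inj v hm0 hv (by omega) (by omega) e; omega
    · intro i
      by_cases e : vx v hm0 (i.val + 1) = y i
      · rw [e, Function.update_self]; exact Nat.le_add_left 1 _
      · rw [Function.update_of_ne e]
    · intro s i hsi hsub
      apply benchCols_not_subset_of_lt hmh (oddCode m s) (oddCode m i)
        (by show (oddCode m s).val < (oddCode m i).val; simp only [oddCode]; have : s.val < i.val := hsi; omega)
      intro c hc
      by_cases hc0 : c = c0
      · rw [hc0]; exact zero_mem_benchCols_odd h0 s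
      · exact Finset.mem_of_mem_erase (hsub (Finset.mem_erase.mpr ⟨hc0, hc⟩))
  -- (3) the split
  have hS₁ : ∀ i : Fin a, ∀ p ∈ S₁ i, p ∉ I := by
    intro i p hp
    have hi := i.2
    have hp' : p = vx v hm0 (b + i.val) ∨ p = vx v hm0 (b + i.val + 1) := by simpa [S₁, cycEdge] using hp
    rcases hp' with e | e
    · rw [e, memI _ (by omega)]; omega
    · by_cases hlast : b + i.val + 1 = m
      · rw [e, hlast, vx_mod_self, memI _ hm0]; omega
      · rw [e, memI _ (by omega)]; omega
  have hyS : ∀ i : Fin b, y i ∈ S₂ i := by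
    intro i
    show vx v hm0 (max i.val 1) ∈ ({vx v hm0 i.val, vx v hm0 (i.val + 1)} : Finset (Fin h))
    by_cases hi : i.val = 0
    · have : max i.val 1 = i.val + 1 := by omega
      rw [this]; simp
    · have : max i.val 1 = i.val := by omega
      rw [this]; simp
  have hyI : ∀ i : Fin b, y i ∈ I := by
    intro i
    have hi := i.2
    show vx v hm0 (max i.val 1) ∈ I
    rw [memI _ (by omega)]; omega
  have hdom : ∀ i : Fin b, ∀ p ∈ S₂ i, p ∈ I → p ≠ y i → rk v (y i) < rk v p := by
    intro i p hp hpI hne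
    have hi := i.2
    have hp' : p = vx v hm0 i.val ∨ p = vx v hm0 (i.val + 1) := by simpa [S₂, cycEdge] using hp
    by_cases hi0 : i.val = 0
    · exfalso
      rcases hp' with e | e
      · rw [e, memI _ (by omega)] at hpI; omega
      · apply hne
        rw [e]
        show vx v hm0 (i.val + 1) = vx v hm0 (max i.val 1)
        congr 1; omega
    · have hmax : max i.val 1 = i.val := by omega
      have hy : y i = vx v hm0 i.val := by
        show vx v hm0 (max i.val 1) = vx v hm0 i.val
        rw [hmax]
      rcases hp' with e | e
      · exact absurd (e.trans hy.symm) hne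
      · rw [e, hy, vx_of_lt v hm0 (by omega), vx_of_lt v hm0 (by omega), rk_v v hv, rk_v v hv]
        show i.val < i.val + 1
        omega
  have hsplit : PSr (Sum.elim S₁ S₂) (Sum.elim w1a w1b) (Sum.elim T₁ (fun j => insert c0 (T₂ j))) :=
    PSr.split c0 I (rk v) y hin htouch
      (fun j => zero_not_mem_benchCols_even h0 j) (fun j => Finset.notMem_erase c0 _)
      hS₁ hyS hyI hdom (fun _ => le_refl 1)
  -- (4) the glued family is nonsingular at some table; transport to the cycle matrix
  obtain ⟨P, hP⟩ := exists_table_of_psr hsplit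
  refine ⟨P, ?_⟩
  let σ : Fin m → Fin a ⊕ Fin b := fun t => if ht : t.val < b then Sum.inr ⟨t.val, ht⟩ else Sum.inl ⟨t.val - b, by omega⟩
  let τ : Fin m → Fin a ⊕ Fin b := fun j =>
    if hj : j.val % 2 = 0 then Sum.inl ⟨j.val / 2, by omega⟩ else Sum.inr ⟨j.val / 2, by omega⟩
  have hσ : Function.Bijective σ := by
    refine (Fintype.bijective_iff_injective_and_card σ).mpr ⟨?_, by simp [hab]⟩
    intro s t e
    by_cases hs : s.val < b <;> by_cases ht : t.val < b
    · simp only [σ, dif_pos hs, dif_pos ht, Sum.inr.injEq, Fin.mk.injEq] at e; exact Fin.ext e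
    · simp only [σ, dif_pos hs, dif_neg ht] at e; exact absurd e (by simp)
    · simp only [σ, dif_neg hs, dif_pos ht] at e; exact absurd e (by simp)
    · simp only [σ, dif_neg hs, dif_neg ht, Sum.inl.injEq, Fin.mk.injEq] at e; apply Fin.ext; omega
  have hτ : Function.Bijective τ := by
    refine (Fintype.bijective_iff_injective_and_card τ).mpr ⟨?_, by simp [hab]⟩
    intro s t e
    by_cases hs : s.val % 2 = 0 <;> by_cases ht : t.val % 2 = 0
    · simp only [τ, dif_pos hs, dif_pos ht, Sum.inl.injEq, Fin.mk.injEq] at e; apply Fin.ext; omega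
    · simp only [τ, dif_pos hs, dif_neg ht] at e; exact absurd e (by simp)
    · simp only [τ, dif_neg hs, dif_pos ht] at e; exact absurd e (by simp)
    · simp only [τ, dif_neg hs, dif_neg ht, Sum.inr.injEq, Fin.mk.injEq] at e; apply Fin.ext; omega
  let eσ : Fin m ≃ Fin a ⊕ Fin b := Equiv.ofBijective σ hσ
  let eτ : Fin m ≃ Fin a ⊕ Fin b := Equiv.ofBijective τ hτ
  set N : Matrix (Fin a ⊕ Fin b) (Fin a ⊕ Fin b) ℂ := Matrix.of fun x x' =>
    dirE P (Sum.elim S₁ S₂ x) (Sum.elim w1a w1b x) (Sum.elim T₁ (fun j => insert c0 (T₂ j)) x') with hN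
  have hrow : ∀ t : Fin m, Sum.elim S₁ S₂ (eσ t) = cycEdge v hm0 t.val := by
    intro t
    show Sum.elim S₁ S₂ (σ t) = _
    by_cases ht : t.val < b
    · simp only [σ, dif_pos ht, Sum.elim_inr, S₂]
    · simp only [σ, dif_neg ht, Sum.elim_inl, S₁]
      congr 1
      omega
  have hwt : ∀ t : Fin m, Sum.elim w1a w1b (eσ t) = fun _ => 1 := by
    intro t
    show Sum.elim w1a w1b (σ t) = _
    by_cases ht : t.val < b
    · simp only [σ, dif_pos ht, Sum.elim_inr, w1b]
    · simp only [σ, dif_neg ht, Sum.elim_inl, w1a]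
  have hcol : ∀ j : Fin m, Sum.elim T₁ (fun j => insert c0 (T₂ j)) (eτ j) = benchCols h m j := by
    intro j
    show Sum.elim T₁ (fun j => insert c0 (T₂ j)) (τ j) = _
    by_cases hj : j.val % 2 = 0
    · simp only [τ, dif_pos hj, Sum.elim_inl, T₁]
      congr 1
      apply Fin.ext
      simp only [evenCode]
      omega
    · simp only [τ, dif_neg hj, Sum.elim_inr, T₂]
      rw [Finset.insert_erase (zero_mem_benchCols_odd h0 _)]
      congr 1
      apply Fin.ext
      simp only [oddCode]
      omega
  have hM : (Matrix.of fun t j : Fin m => segE P (cycEdge v hm0 t.val) (benchCols h m j)) =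
      (N.submatrix eσ eσ).submatrix id (eτ.trans eσ.symm) := by
    refine Matrix.ext fun t j => ?_
    rw [Matrix.submatrix_apply, Matrix.submatrix_apply, Matrix.of_apply, hN, Matrix.of_apply, id,
      Equiv.trans_apply, Equiv.apply_symm_apply, hrow, hwt, hcol, dirE_one]
  rw [hM, Matrix.det_permute', Matrix.det_submatrix_equiv_self]
  refine mul_ne_zero ?_ hP
  exact_mod_cast (Equiv.Perm.sign (eτ.trans eσ.symm)).ne_zero

end Cycle

end Summit.ValiantsHypothesis.ValiantsHypothesis.Theorems.BarrierLever.ChowBenchmarkHaar
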